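import Literature.AlgebraicGeometry.Hyperkaehler.KummerTypeAssociatedK3Surface
import Literature.AlgebraicGeometry.Hyperkaehler.K3HilbertType
import HarnessLib

/-!
# The `K3^[m]`-type subvariety `W_K` of a projective `Kumⁿ`-type variety and the period of the restriction map `ι^* : H²(K) ↪ H²(W_K)` (Floccari, Geom. Topol. 2026, §5.2, Lemma 5.5; Prop. 4.3, Prop. 4.6, Lemma 4.8) — NAMED FACT

Layer `Literature/AlgebraicGeometry/Hyperkaehler`.  Companion of `KummerTypeAssociatedK3Surface` (same
source, same seat `hodge-lit-oqh-2` of the literature-typing layer D-0088(4), tranche LT-H4; consumers: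
the `Kumⁿ ↔ K3^[m]` TRANSFER lens of the ladder HodgeAV, rungs H2/H3, and the cell `hodge-kum4`, whose
record `Floccari2026_fixedFourfold_kum4Type` (file `GeneralizedKummerTypeFixedFourfold`) carries the
`n = 4` fixed fourfold WITHOUT any statement on `H²` and is marked `TODO(general form)`): the geometric
half of Floccari's construction — INSIDE every projective `K` of `Kumⁿ`-type sits a hyper-Kähler
subvariety `W_K` of `K3^[m]`-type (`2m = n` or `n + 1`) onto whose transcendental lattice the
restriction map carries `H²_tr(K)` isomorphically (Beauville–Bogomolov form doubled), `ι^*` being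
injective on all of `H²(K)`.  Recorded in existence form on the real carriers, with the transcendental
parts `transcendentalPart X b = NS(X)^{⊥_b} ⊗ ℂ` of the companion file.

## Source (read at source; locators = files of the materialised arXiv text `paper:arxiv-2501.02315`)

S. Floccari, *K3 surfaces associated with varieties of generalized Kummer type*, Geom. Topol. 30 (2026)
1129–1154 (arXiv:2501.02315) [`Floccari2026`; REFEREED].  §1 [p0003:L9–L11], verbatim: "there exists a
natural subvariety `W_K` of `K` which is a hyper-Kähler variety of `K3^[m]`-type where either `2m = n` or
`2m = n+1`, with the key property of deforming everywhere together with `K` […] It is obtained as the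
component of maximal dimension of the fixed locus of an involution of `K` which acts trivially on the
second cohomology group […] we show that the pull-back along `ι : W_K ↪ K` induces a primitive embedding
of lattices and Hodge structures `ι^* : H²_tr(K,ℤ)(2) ⥲ H²_tr(W_K,ℤ)`, where on the left-hand side the
form is multiplied by `2`."  §5.2 [p0017:L1–L4]: "Taking the fibre over `b₀`, we get a submanifold
`ι : W_K ↪ K` of `K3^[m]`-type."  **Lemma 5.5** [p0017:L6–L14], verbatim: "The pull-back along
`ι : W_K ↪ K` induces a primitive embedding of lattices and Hodge structures `ι^* : H²(K,ℤ)(2) ↪ H²(W_K,ℤ)`.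
In particular, `ι^*` induces a Hodge isometry `H²_tr(K,ℤ)(2) ⥲ H²_tr(W_K,ℤ)` of transcendental
lattices."  It rests on **Prop. 4.3** [p0010:L37–L44] (the Kummer point `Km(A)^[m] ↪ Kⁿ(A)`: "a
primitive embedding `ι^* : H²(Kⁿ(A),ℤ)(2) ↪ H²(W,ℤ)` of lattices and Hodge structures, where on the
left-hand side the form is multiplied by a factor `2`"), **Prop. 4.6** [p0014:L11–L22] (the family
`𝒲 → B` of `K3^[m]`-type manifolds with a closed embedding `ι : 𝒲 ↪ 𝒦` over `B`, up to finite étale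
base change) and **Lemma 4.8** [p0014:L38–L40]: "For any `b ∈ B`, the pull-back
`ι_b^* : H²(𝒦_b,ℤ) → H²(𝒲_b,ℤ)` is injective and multiplies the form by a factor `2`."  After Prop. 4.3
[p0010:L45]: "The cases `n = 2` and `n = 3` may be deduced from [Hassett–Tschinkel] and [Floccari 2023],
respectively."  **Prop. 5.6** [p0017:L19–L24]: "if `n = 2`, `W_K` is isomorphic to the K3 surface `S_K`;
if `n ≥ 3`, `W_K ⊂ K` is birational to a smooth and projective moduli space `M_{S_K,H}(v)`".

## Rendering (tree carriers) and faithfulness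

For `2 ≤ n`, `K` smooth projective of dimension `2n` of `Kumⁿ`-type (`IsOfGeneralizedKummerType n K`)
and a Fujiki form `b` on `H²(K(ℂ); ℂ)` (`IsFujikiForm n K b`, the Beauville–Bogomolov form up to `ℂˣ`):
* "`W_K` of `K3^[m]`-type, `2m = n` or `2m = n + 1`, a submanifold `ι : W_K ↪ K`": `m` with
  `2 * m = n ∨ 2 * m = n + 1`, `W` with `Motives.IsSmoothProjective (2 * m) W` (a closed submanifold of
  the projective `K`), `IsOfK3HilbertType m W` (file `K3HilbertType`: deformation equivalent in dimension
  `2m` to `S₀^[m]` for a K3 surface `S₀`), and `i : W ⟶ K` with `IsClosedImmersion i.left` — the clause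
  used by the `Kum⁴` fixed-fourfold record; `i^* = HodgeTheory.complexBetti.map i 2`.
* "`ι^*` injective and multiplies the [Beauville–Bogomolov] form by a factor `2`": `i^*` is INJECTIVE on
  `H²(K(ℂ); ℂ)` and there is a Fujiki form `b_W` on `H²(W(ℂ); ℂ)` (`IsFujikiForm m W b_W`; for `m = 1`,
  `W ≅ S_K` a K3 surface and `b_W` is the intersection form up to scalar) with
  `b_W(i^*x, i^*y) = b(x, y)` for all `x, y` — a SIMILITUDE on all of `H²(K)`; the factor `2` is absorbed
  in the choice of `b_W` and NOT recorded (both forms are pinned only up to scalar) — WEAKER only there.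
* "`ι^*` induces a Hodge isometry `H²_tr(K,ℤ)(2) ⥲ H²_tr(W_K,ℤ)`": `i^*` restricts to a BIJECTION
  `transcendentalPart K b → transcendentalPart W b_W` (`Set.BijOn`; complexified — `i^*`, a pull-back, is
  a morphism of Hodge structures defined over `ℤ`, so this is the rational/integral statement up to the
  unrecorded primitivity).
* NOT recorded: primitivity (saturation) of `ι^*(H²(K,ℤ))`; "deforming everywhere together with `K`";
  the fixed-locus description (for `n = 4` it is `Floccari2026_fixedFourfold_kum4Type`, whose `W` print
  identifies with `W_K` — the two records are not identified here); Prop. 5.6 (moduli spaces of sheaves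
  are not in the tree).  ∀ over Fujiki forms `b`: safe side (vacuous only if none exists).
  Grade: REFEREED (Geom. Topol. 2026).  HONEST FRAMING: typed ≠ proved; nothing here bears on the Hodge
  conjecture by itself.

## Content and D-0026 accounting

ONE named fact (+1; a refereed published theorem cited at the line; `lean search` for
`K3HilbertType.*Kummer|fixedFourfold|W_K` finds only the `Kum⁴` fixed-fourfold record, with no `H²`
statement): `Floccari2026_k3HilbertTypeSubvariety_kummerType`.  Kernel: the `Kum⁴` and `Kum³` spellings
(`m = 2` forced by `omega`), and `restrict_eq_zero_iff`.
-/

noncomputable section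

open CategoryTheory _root_.AlgebraicGeometry
open Literature.AlgebraicTopology.SingularHomology

namespace Literature.AlgebraicGeometry.Hyperkaehler

open HodgeTheory

/-! ### The named fact -/

/-- **Floccari 2026, §5.2 with Lemma 5.5 (from Prop. 4.3, Prop. 4.6, Lemma 4.8): the `K3^[m]`-type
subvariety `W_K` of a projective `Kumⁿ`-type variety and the period of the restriction map.**  For every
smooth projective complex `K` of `Kumⁿ`-type, `n ≥ 2`, and every Fujiki form `b` on `H²(K(ℂ); ℂ)`, there
are `m` with `2m = n` or `2m = n + 1`, a smooth projective `W` of dimension `2m` of `K3^[m]`-type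
("a submanifold `ι : W_K ↪ K` of `K3^[m]`-type"), a closed immersion `i : W ⟶ K` and a Fujiki form `b_W`
on `H²(W(ℂ); ℂ)` such that the pull-back `i^* : H²(K(ℂ); ℂ) → H²(W(ℂ); ℂ)` is injective and isometric
from `b` to `b_W` ("`ι^* : H²(K,ℤ)(2) ↪ H²(W_K,ℤ)` … injective and multiplies the form by a factor `2`";
the factor is absorbed in `b_W`, module docstring) and restricts to a bijection of the transcendental
parts `NS(K)^{⊥_b} ⊗ ℂ → NS(W)^{⊥_{b_W}} ⊗ ℂ` ("`ι^*` induces a Hodge isometry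
`H²_tr(K,ℤ)(2) ⥲ H²_tr(W_K,ℤ)` of transcendental lattices").  Primitivity of the image, the
deformation property and the fixed-locus / moduli descriptions are not recorded (module docstring;
for `n = 4` see `Floccari2026_fixedFourfold_kum4Type`).  A THEOREM in print (status: proved; REFEREED:
Geom. Topol. 2026; `n = 2, 3` earlier by Hassett–Tschinkel and Floccari 2023, loc. cit. after Prop. 4.3;
unproved in the tree).
[cite: Floccari2026, §5.2 and Lemma 5.5, with Prop. 4.3, Prop. 4.6 and Lemma 4.8 (§4)] -/
def Floccari2026_k3HilbertTypeSubvariety_kummerType : Prop :=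
  ∀ (n : ℕ), 2 ≤ n → ∀ ⦃K : Motives.SchemeOver ℂ⦄, Motives.IsSmoothProjective (2 * n) K →
    IsOfGeneralizedKummerType n K →
    ∀ (b : complexBetti K 2 →ₗ[ℂ] complexBetti K 2 →ₗ[ℂ] ℂ), IsFujikiForm n K b →
      ∃ (m : ℕ) (W : Motives.SchemeOver ℂ) (i : W ⟶ K)
        (bW : complexBetti W 2 →ₗ[ℂ] complexBetti W 2 →ₗ[ℂ] ℂ),
        (2 * m = n ∨ 2 * m = n + 1) ∧
        Motives.IsSmoothProjective (2 * m) W ∧ IsOfK3HilbertType m W ∧ IsClosedImmersion i.left ∧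
        IsFujikiForm m W bW ∧
        Function.Injective (complexBetti.map i 2) ∧
        (∀ x y : complexBetti K 2, bW (complexBetti.map i 2 x) (complexBetti.map i 2 y) = b x y) ∧
        Set.BijOn (complexBetti.map i 2) (transcendentalPart K b) (transcendentalPart W bW)

namespace Floccari2026_k3HilbertTypeSubvariety_kummerType

/-- The `Kum⁴` spelling (dimension `8`): `2m = 4` or `2m = 5` forces `m = 2` — the `K3^[m]`-type
subvariety of a projective `Kum⁴`-type variety is a FOURFOLD of `K3^[2]`-type (print: the fixed fourfold
`W_K` of `Floccari2026_fixedFourfold_kum4Type`), with `i^*` injective, isometric and bijective on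
transcendental parts. [cite: Floccari2026, §5.2, Lemma 5.5 and Lemma 4.2 (n = 2m = 4)] -/
theorem kum4Type (h : Floccari2026_k3HilbertTypeSubvariety_kummerType) {K : Motives.SchemeOver ℂ}
    (hK : Motives.IsSmoothProjective 8 K) (hKum : IsOfGeneralizedKummerType 4 K)
    {b : complexBetti K 2 →ₗ[ℂ] complexBetti K 2 →ₗ[ℂ] ℂ} (hb : IsFujikiForm 4 K b) :
    ∃ (W : Motives.SchemeOver ℂ) (i : W ⟶ K) (bW : complexBetti W 2 →ₗ[ℂ] complexBetti W 2 →ₗ[ℂ] ℂ),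
      Motives.IsSmoothProjective 4 W ∧ IsOfK3HilbertType 2 W ∧ IsClosedImmersion i.left ∧
      IsFujikiForm 2 W bW ∧
      Function.Injective (complexBetti.map i 2) ∧
      (∀ x y : complexBetti K 2, bW (complexBetti.map i 2 x) (complexBetti.map i 2 y) = b x y) ∧
      Set.BijOn (complexBetti.map i 2) (transcendentalPart K b) (transcendentalPart W bW) := by
  obtain ⟨m, W, i, bW, hm, hW, hK3, hi, hbW, hinj, hiso, hbij⟩ := h 4 (by norm_num) hK hKum b hb
  have hm2 : m = 2 := by omega
  subst hm2
  exact ⟨W, i, bW, hW, hK3, hi, hbW, hinj, hiso, hbij⟩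

/-- The `Kum³` spelling (dimension `6`): `m = 2` again (`2m = 3` is impossible, `2m = 4`) — a projective
hyperkähler SIXFOLD of generalized Kummer type contains a `K3^[2]`-type FOURFOLD `W` with `i^*` injective,
isometric and bijective on transcendental parts. [cite: Floccari2026, §5.2, Lemma 5.5 (n = 3 = 2m - 1, m = 2)] -/
theorem kum3Type (h : Floccari2026_k3HilbertTypeSubvariety_kummerType) {K : Motives.SchemeOver ℂ}
    (hK : Motives.IsSmoothProjective 6 K) (hKum : IsOfGeneralizedKummerType 3 K)
    {b : complexBetti K 2 →ₗ[ℂ] complexBetti K 2 →ₗ[ℂ] ℂ} (hb : IsFujikiForm 3 K b) :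
    ∃ (W : Motives.SchemeOver ℂ) (i : W ⟶ K) (bW : complexBetti W 2 →ₗ[ℂ] complexBetti W 2 →ₗ[ℂ] ℂ),
      Motives.IsSmoothProjective 4 W ∧ IsOfK3HilbertType 2 W ∧ IsClosedImmersion i.left ∧
      IsFujikiForm 2 W bW ∧
      Function.Injective (complexBetti.map i 2) ∧
      (∀ x y : complexBetti K 2, bW (complexBetti.map i 2 x) (complexBetti.map i 2 y) = b x y) ∧
      Set.BijOn (complexBetti.map i 2) (transcendentalPart K b) (transcendentalPart W bW) := by
  obtain ⟨m, W, i, bW, hm, hW, hK3, hi, hbW, hinj, hiso, hbij⟩ := h 3 (by norm_num) hK hKum b hb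
  have hm2 : m = 2 := by omega
  subst hm2
  exact ⟨W, i, bW, hW, hK3, hi, hbW, hinj, hiso, hbij⟩

/-- Transcendental classes of `K` restrict injectively to `W`: a class in `NS(K)^{⊥_b} ⊗ ℂ` with zero
restriction is zero (from injectivity of `i^*` on all of `H²(K)`). [cite: Floccari2026, Lemma 5.5 and Lemma 4.8] -/
theorem restrict_eq_zero_iff (h : Floccari2026_k3HilbertTypeSubvariety_kummerType) {n : ℕ} (hn : 2 ≤ n)
    {K : Motives.SchemeOver ℂ} (hK : Motives.IsSmoothProjective (2 * n) K)
    (hKum : IsOfGeneralizedKummerType n K)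
    {b : complexBetti K 2 →ₗ[ℂ] complexBetti K 2 →ₗ[ℂ] ℂ} (hb : IsFujikiForm n K b) :
    ∃ (m : ℕ) (W : Motives.SchemeOver ℂ) (i : W ⟶ K),
      (2 * m = n ∨ 2 * m = n + 1) ∧ Motives.IsSmoothProjective (2 * m) W ∧ IsOfK3HilbertType m W ∧
      ∀ x : complexBetti K 2, complexBetti.map i 2 x = 0 ↔ x = 0 := by
  obtain ⟨m, W, i, bW, hm, hW, hK3, -, -, hinj, -, -⟩ := h n hn hK hKum b hb
  refine ⟨m, W, i, hm, hW, hK3, fun x ↦ ⟨fun hx ↦ hinj ?_, fun hx ↦ by rw [hx, map_zero]⟩⟩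
  rw [hx, map_zero]

end Floccari2026_k3HilbertTypeSubvariety_kummerType

end Literature.AlgebraicGeometry.Hyperkaehler

end
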